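/-
Copyright (c) 2026 the pub-hodgecm-mathlib formalisation cell (harness21).  Prover seat hodgecm-mathlib-K2E3-p29 (g3): Track B «K2-LIT», hLiu418 = stmt-HodgeConjecture-24832; socket #41,
KIND W, (iii-fin) row, (R) pole FILE 3 (hypothesis-first) — KW desk F0P2-p08 (g4) re-cut 2026-09-05T01:23:54Z, architect K2E3-p06 (g7) «=» 01:29:33Z.  THEOREMS ONLY (no `def`, no `sorry`).
-/
import Summits.HodgeConjecture.HodgeConjecture.Theorems.K2LiuKindWFiniteLetterHolomorphic     -- ★ p863793 (this base, g2): §1 `beta_skew`, `beta_mul_betaInv`, `setIntegral_kindWLocalBall_eq_setIntegral_skew_tate`; ★ p863154 defs; ★ B2 chart currency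
import Summits.HodgeConjecture.HodgeConjecture.Theorems.K2LiuKindWFactorLevelInvarianceBall   -- ★ p864075 (this base, g2): LEVEL currency of ★ p863964 (`congruenceGL (n+n) (valuation ϖ_w ^ M)`), ★ F3c-1 valuation balls
import HarnessLib

/-!
# Crux `HLiu418`, socket #41, KIND W — (R) FILE 3 `K2LiuKindWFiniteRadiusStabilityOfLetters`: THE RADIUS-STABILITY LETTER `hstab` OF ★ p863720, HYPOTHESIS-FIRST

Cell `hodgecm-mathlib`, hLiu418 = `stmt-HodgeConjecture-24832` (helper lane, count-neutral), route `HCCMUnconditional`; squad K2 ∕ K2Liu, socket #41, KIND W, (iii-fin) row, pole (R) =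
the radius-stability letter of ★ p863720 `K2LiuKindWFiniteSizeLetterOfPlace.hsizeLoc_of_place` (:215–:240): for a non-singular index `S`, `h ∈ H(𝔸)`, `v ∈ U(S,h)`, `s` and exponents
`dS, dA` bounding the entries of `S`, `S⁻¹` above `v`, the ball integrals `∫_{ball_v(−k′)} conj ψ_S(ι_v y)·F_{v,j}(S,h)(s)(W_v·y·h_v) dν_v` are CONSTANT beyond a radius
**`R ≤ Σ_{w∣v} (ρ w + a₁·lev h w + a₂·dS w + a₃·dA w)`**, `ρ` supported on a FIXED finite `Tρ`, `a₁ a₂ a₃` uniform (the linear shape ★ p863720 :264ff needs; K2E3-p06 (g7) census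
01:18:40Z).  The (R) pole is three files (KW desk re-cut 01:23:54Z): FILE 2 ★∕📤 p864134 `K2LiuBadPlaceWhittakerFarShellsLevel` (Karel's far shells, radius AFFINE in the principal
level), its Φ5-tie twin `K2LiuBadPlaceWhittakerBallLevel` (F0P2-p09 (g3)), and THIS FILE — the instantiation layer at the K2Lit CM frame, every analytic input BY VALUE:
the frame of ★ p863720 (`T₀ νv π hπ FvT`); the Siegel-section letters `hf hfc` of the factors at NON-SINGULAR indices for a character family `χv` (★ p863793 §3 shapes); uniformisers
`ϖ w` and the LEVEL letter `hMinv` of the translated factors at exponent `M h w` (★ p863964 §4 shape: `FvT(y·k·h_v) = FvT(y·h_v)` for `k_w ∈ congruenceGL (n+n) (valuation ϖ_w ^ M h w)`)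
with `hMlev : M ≤ lev`, `hMK : h_v ∉ K_{H,v} ⇒ ∃ w ∣ v, 1 ≤ M h w` ((ι) ★ p864124); per-place constants `K₀ v` (Karel), `cb v` (index threshold), `c₂ v` (two-adic letter `h2`) and ONE
UNIFORMITY letter `hTK : ∀ v ∉ TK, K₀ v + 4(cb v + c₂ v) ≤ Kg`; and the per-place KAREL-WITH-LEVEL letter `hballM` in Skew currency = the twin's conclusion shape at the CM frame: at each
`v` SOME ★ B2 chart `ψ : N_Δ(L⁺_v) ≃ₜ Skew_v` such that for every level exponent `Mv`, translate `x`, Siegel family `f` of level `Mv` after translation, `0 ≤ b, b′`, `cb v ≤ b`, `gramS`-skew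
`β` with `ββ⁻ = 1`, `β ∈ ball(−b)`, `β⁻ ∈ ball(−b′)`, all `s` and `k ≥ K₀ v + Σ_w Mv w + 4b + 2b′`: `∫_{B(−k)} f s (w_Δ n(t) x) ψ_{L⁺,v}(−Tr tr(β t)) d(ψ_*ν_v) = ∫_{B(−(K₀ v + Σ Mv + 4b + 2b′))} …`.
OUTPUT `hstab_of_letters`: `∃ Tρ ρ a₁ a₂ a₃, (∀ w ∉ Tρ, ρ w = 0) ∧ ‹hstab :216–:240 VERBATIM›` (`a₁ a₂ a₃ := 1+Kg, 4+Kg, 2+Kg`; `Tρ` := the places of `L` over `TK ∪ T₀ ∪ {(w_Δ)_v ∉ K_v}`,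
finite by ★ `eventually_evalPlace_mem_localInt`; `ρ := (K₀ v)⁺ + 4(cb v + c₂ v)` there).  PROOF: §1 the index block `β := −½·(S⊗1) ∈ ball(−b)`, `β⁻ := −2·(S⁻¹⊗1) ∈ ball(−b′)` for
`b := cb v + c₂ v + Σ_w dS w`, `b′ := Σ_w dA w` (`|½|_w ≤ |π_v|_w^{−c₂}`, `exp(d) ≤ |π_v|_w^{−d}` by ★ `valued_toPlace_uniformizer_le` and `WithZero.log`); §2 the radius bookkeeping
`toNat_radius_le` with the absorption premise ON `Tρ` (`absorb_on`: the fibre carries `ρ`) and OFF `Tρ` (`absorb_off`: `v ∈ U(S,h) ∖ (T₀ ∪ T_Δ)` has `h_v ∉ K_v` or a non-integral entry of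
`S`, `S⁻¹` above it — ★ `kindWPlaces` :99–:109 — so `Σ_w (lev + dS + dA) ≥ 1` absorbs `Kg` via `hMK hMlev hTK`); §3 the head: `hballM` at `(M h, h_v, FvT j S h v)` with ★ `beta_skew` ∕
`beta_mul_betaInv`, ★ B4 `evalPlace_finPart_weylDelta` and the ball transport ★ `setIntegral_kindWLocalBall_eq_setIntegral_skew_tate` ×2.
HONEST LABEL.  Count-neutral helper, closes no socket: `HC_CM` is proved only modulo the 7 printed citations (2 remaining named inputs: hLiu418 = `stmt-HodgeConjecture-24832`, h413 =
`stmt-HodgeConjecture-24833`) until rung 0 closes.  NOT HERE (by value): `hballM` (payer FILE 2 + twin), `K₀ cb c₂` and the UNIFORMITY letter `hTK` (FILE 2's `∃ K₀` is per place; a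
cofinite bound needs an explicit-radius edition at the good places — flagged on the bus), the letters of the concrete factors ((KW-fac), (ι)), the closed head `hstab_of_level_conductor`.

## References
* [KudlaRallis1994] S. Kudla, S. Rallis, Ann. of Math. 140 (1994): §2.   * [Casselman1980] W. Casselman, Compositio Math. 40 (1980): §3 (Karel's lemma; principal levels).
* [Shimura1997] G. Shimura, CBMS 93 (1997): §18.1 (18.4), §18.3–18.4.   * [Weil1965] A. Weil, *L'intégration dans les groupes topologiques* (1965): §37.
* [PlatonovRapinchuk1994] V. Platonov, A. Rapinchuk, *Algebraic Groups and Number Theory* (1994): §5.1.   * [CasselsFrohlichANT1967] Cassels–Fröhlich (1967): Ch. II §10.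
-/

set_option autoImplicit false
-- the mandated namespace repeats the single-problem summit's segment (`HodgeConjecture.HodgeConjecture`)
set_option linter.dupNamespace false
noncomputable section
open scoped Matrix RestrictedProduct ENNReal NNReal Topology ComplexConjugate BigOperators
open NumberField IsDedekindDomain MeasureTheory Measure Filter Set Metric ValuativeRel

namespace Summit.HodgeConjecture.HodgeConjecture.Cruxes.HLiu418.K2LiuKindWFiniteRadiusStabilityOfLetters

open Literature.NumberTheory.Automorphic hiding IsKFinite
open Literature.NumberTheory.Automorphic.UnitaryGroup Literature.NumberTheory.GaloisRepresentations Literature.NumberTheory.LFunctions Literature.NumberTheory.GelbartRogawski1991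
open Literature.NumberTheory.GelbartRogawski1991.GRConstruction Literature.NumberTheory.GelbartRogawski1991.AdaptedBlocks Literature.NumberTheory.GelbartRogawski1991.UnitaryDualPair
open Literature.NumberTheory.K2Lit Literature.NumberTheory.K2Lit.SiegelDoubled Literature.NumberTheory.K2Lit.LocalSiegelDoubled Literature.NumberTheory.K2Lit.PlaceSplitting
open Summit.HodgeConjecture.HodgeConjecture.Cruxes.HLiu418.K2LiuSiegelUnipotentLocalDefs Summit.HodgeConjecture.HodgeConjecture.Cruxes.HLiu418.K2LiuSiegelUnipotentFourierDefs
open Summit.HodgeConjecture.HodgeConjecture.Cruxes.HLiu418.K2LiuSiegelEisensteinKindWLetters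
open Summit.HodgeConjecture.HodgeConjecture.Cruxes.HLiu418.K2LiuLocalWhittakerFactorSkew (evalPlace_finPart_weylDelta)
open Summit.HodgeConjecture.HodgeConjecture.Cruxes.HLiu418.K2LiuKindWFiniteLetterDefs (kindWLocalBall mem_kindWLocalBall_iff)
open Summit.HodgeConjecture.HodgeConjecture.Cruxes.HLiu418.K2LiuKindWFiniteLetterHolomorphic (beta_skew beta_mul_betaInv setIntegral_kindWLocalBall_eq_setIntegral_skew_tate)
open Summit.HodgeConjecture.HodgeConjecture.Cruxes.HLiu418.K2LiuLocalRingValuationBalls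
  (valued_toPlace_uniformizer_le valued_toPlace_uniformizer_ne_zero valued_toPlace_uniformizer_le_one)

variable (L : Type) [Field L] [NumberField L] [IsCMField L]
variable {N M n : ℕ} (e : Fin N × Fin M ≃ Fin n)
  (dV : Fin N → L) (hdV : ∀ i, IsCMField.complexConj L (dV i) = dV i)
  (dW : Fin M → L) (hdW : ∀ i, IsCMField.complexConj L (dW i) = dW i)
  (v : HeightOneSpectrum (𝓞 (Fp L)))

/-! ## §1 The index block `β = −½·(S⊗1)`, `β⁻ = −2·(S⁻¹⊗1)` lies in the balls `ball(−b)`, `ball(−b′)` read off the entry bounds `dS`, `dA` -/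

section IndexBalls
omit [IsCMField L] in
/-- `exp(d) ≤ |π_v|_w^{−d}` for `d ≥ 0`: `|π_v|_w ≤ exp(−1)` (★ `valued_toPlace_uniformizer_le`; `WithZero.log` linearises). [cite: CasselsFrohlichANT1967, Ch. II §10] -/
theorem exp_natCast_le_zpow_neg {π : v.adicCompletion (Fp L)} (hπ : Valued.v π = WithZero.exp (-1 : ℤ)) (w : UnitaryGroup.PlacesOver L v) (d : ℕ) :
    WithZero.exp ((d : ℕ) : ℤ) ≤ Valued.v (UnitaryGroup.toPlace v w π) ^ (-((d : ℕ) : ℤ)) := by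
  have h0 := valued_toPlace_uniformizer_ne_zero (Fp L) L v hπ w
  have h1 := valued_toPlace_uniformizer_le (Fp L) L v hπ w
  obtain ⟨ℓ, hℓ⟩ : ∃ ℓ : ℤ, Valued.v (UnitaryGroup.toPlace v w π) = WithZero.exp ℓ := ⟨_, (WithZero.exp_log h0).symm⟩
  rw [hℓ, WithZero.exp_le_exp] at h1
  rw [hℓ, ← WithZero.exp_zsmul, smul_eq_mul, WithZero.exp_le_exp]
  nlinarith

omit [IsCMField L] in
/-- `|½|_w ≤ |π_v|_w^{−c₂}` from the two-adic letter `|π_v|_w^{c₂} ≤ |2|_w` (`⅟2 · 2 = 1` in `∏_{w∣v} L_w`). [cite: PlatonovRapinchuk1994, §5.1] -/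
theorem valued_invOf_two_le {π : v.adicCompletion (Fp L)} (hπ : Valued.v π = WithZero.exp (-1 : ℤ)) (w : UnitaryGroup.PlacesOver L v) {c₂ : ℕ}
    (h2 : Valued.v (UnitaryGroup.toPlace v w π) ^ (c₂ : ℤ) ≤ Valued.v (2 : w.1.adicCompletion L)) :
    Valued.v ((⅟(2 : UnitaryGroup.LocalRing L v)) w) ≤ Valued.v (UnitaryGroup.toPlace v w π) ^ (-(c₂ : ℤ)) := by
  have h0 := valued_toPlace_uniformizer_ne_zero (Fp L) L v hπ w
  have hinv : Valued.v ((⅟(2 : UnitaryGroup.LocalRing L v)) w) * Valued.v (2 : w.1.adicCompletion L) = 1 := by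
    rw [← map_mul]
    have h := congrArg (fun f : UnitaryGroup.LocalRing L v => f w) (invOf_mul_self (2 : UnitaryGroup.LocalRing L v))
    simp only [Pi.mul_apply, Pi.ofNat_apply] at h
    rw [h, map_one]
  have hpow0 : Valued.v (UnitaryGroup.toPlace v w π) ^ (c₂ : ℤ) ≠ 0 := zpow_ne_zero _ h0
  calc Valued.v ((⅟(2 : UnitaryGroup.LocalRing L v)) w)
      = Valued.v ((⅟(2 : UnitaryGroup.LocalRing L v)) w) * (Valued.v (UnitaryGroup.toPlace v w π) ^ (c₂ : ℤ) * Valued.v (UnitaryGroup.toPlace v w π) ^ (-(c₂ : ℤ))) := by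
        rw [← zpow_add₀ h0, add_neg_cancel, zpow_zero, mul_one]
    _ ≤ Valued.v ((⅟(2 : UnitaryGroup.LocalRing L v)) w) * (Valued.v (2 : w.1.adicCompletion L) * Valued.v (UnitaryGroup.toPlace v w π) ^ (-(c₂ : ℤ))) :=
        mul_le_mul' le_rfl (mul_le_mul' h2 le_rfl)
    _ = Valued.v (UnitaryGroup.toPlace v w π) ^ (-(c₂ : ℤ)) := by rw [← mul_assoc, hinv, one_mul]

omit [IsCMField L] in
/-- **`β := −½·(S⊗1) ∈ ball(−b)`** for `b ≥ c₂ + dS w` at every `w ∣ v`, given `|S_{ij}|_w ≤ exp(dS w)` and the two-adic letter. [cite: Shimura1997, §18.1] [cite: CasselsFrohlichANT1967, Ch. II §10] -/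
theorem beta_mem_ball {π : v.adicCompletion (Fp L)} (hπ : Valued.v π = WithZero.exp (-1 : ℤ)) {c₂ : ℕ}
    (h2 : ∀ w : UnitaryGroup.PlacesOver L v, Valued.v (UnitaryGroup.toPlace v w π) ^ (c₂ : ℤ) ≤ Valued.v (2 : w.1.adicCompletion L))
    (S : Matrix (Fin n) (Fin n) L) (dS : HeightOneSpectrum (𝓞 L) → ℕ)
    (hdS : ∀ (w : UnitaryGroup.PlacesOver L v) (a b : Fin n), Valued.v (((S a b : L)) : w.1.adicCompletion L) ≤ WithZero.exp ((dS w.1 : ℕ) : ℤ))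
    {b : ℤ} (hb : ∀ w : UnitaryGroup.PlacesOver L v, (c₂ : ℤ) + dS w.1 ≤ b) :
    ∀ i j (w : UnitaryGroup.PlacesOver L v), Valued.v ((-(⅟(2 : UnitaryGroup.LocalRing L v) • S.map (algebraMap L (UnitaryGroup.LocalRing L v)))) i j w) ≤
      Valued.v (UnitaryGroup.toPlace v w π) ^ (-b) := by
  intro i j w
  have h0 := valued_toPlace_uniformizer_ne_zero (Fp L) L v hπ w
  have h1 := valued_toPlace_uniformizer_le_one (Fp L) L v hπ w
  have hentry : (-(⅟(2 : UnitaryGroup.LocalRing L v) • S.map (algebraMap L (UnitaryGroup.LocalRing L v)))) i j w =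
      -((⅟(2 : UnitaryGroup.LocalRing L v)) w * (((S i j : L)) : w.1.adicCompletion L)) := by
    simp only [Matrix.neg_apply, Matrix.smul_apply, Matrix.map_apply, smul_eq_mul, Pi.neg_apply, Pi.mul_apply, Pi.algebraMap_apply]
    rfl
  rw [hentry, Valuation.map_neg, map_mul]
  calc Valued.v ((⅟(2 : UnitaryGroup.LocalRing L v)) w) * Valued.v (((S i j : L)) : w.1.adicCompletion L)
      ≤ Valued.v (UnitaryGroup.toPlace v w π) ^ (-(c₂ : ℤ)) * Valued.v (UnitaryGroup.toPlace v w π) ^ (-((dS w.1 : ℕ) : ℤ)) :=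
        mul_le_mul' (valued_invOf_two_le L v hπ w (h2 w)) ((hdS w i j).trans (exp_natCast_le_zpow_neg L v hπ w (dS w.1)))
    _ = Valued.v (UnitaryGroup.toPlace v w π) ^ (-((c₂ : ℤ) + dS w.1)) := by rw [← zpow_add₀ h0, neg_add]
    _ ≤ Valued.v (UnitaryGroup.toPlace v w π) ^ (-b) := zpow_le_zpow_right_of_le_one₀ (zero_lt_iff.2 h0) h1 (neg_le_neg (hb w))

omit [IsCMField L] in
/-- **`β⁻ := −2·(S⁻¹⊗1) ∈ ball(−b′)`** for `b′ ≥ dA w` at every `w ∣ v`, given `|S⁻¹_{ij}|_w ≤ exp(dA w)` (`|2|_w ≤ 1`). [cite: Shimura1997, §18.1] [cite: CasselsFrohlichANT1967, Ch. II §10] -/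
theorem betaInv_mem_ball {π : v.adicCompletion (Fp L)} (hπ : Valued.v π = WithZero.exp (-1 : ℤ))
    (A : Matrix (Fin n) (Fin n) L) (dA : HeightOneSpectrum (𝓞 L) → ℕ)
    (hdA : ∀ (w : UnitaryGroup.PlacesOver L v) (a b : Fin n), Valued.v (((A a b : L)) : w.1.adicCompletion L) ≤ WithZero.exp ((dA w.1 : ℕ) : ℤ))
    {b' : ℤ} (hb' : ∀ w : UnitaryGroup.PlacesOver L v, (dA w.1 : ℤ) ≤ b') :
    ∀ i j (w : UnitaryGroup.PlacesOver L v), Valued.v ((-((2 : UnitaryGroup.LocalRing L v) • A.map (algebraMap L (UnitaryGroup.LocalRing L v)))) i j w) ≤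
      Valued.v (UnitaryGroup.toPlace v w π) ^ (-b') := by
  intro i j w
  have h0 := valued_toPlace_uniformizer_ne_zero (Fp L) L v hπ w
  have h1 := valued_toPlace_uniformizer_le_one (Fp L) L v hπ w
  have hentry : (-((2 : UnitaryGroup.LocalRing L v) • A.map (algebraMap L (UnitaryGroup.LocalRing L v)))) i j w =
      -((2 : w.1.adicCompletion L) * (((A i j : L)) : w.1.adicCompletion L)) := by
    simp only [Matrix.neg_apply, Matrix.smul_apply, Matrix.map_apply, smul_eq_mul, Pi.neg_apply, Pi.mul_apply, Pi.ofNat_apply, Pi.algebraMap_apply]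
    rfl
  have htwo : Valued.v (2 : w.1.adicCompletion L) ≤ 1 := by
    have h := Valuation.map_add (Valued.v : Valuation (w.1.adicCompletion L) _) 1 1
    rw [one_add_one_eq_two, Valuation.map_one, max_self] at h
    exact h
  rw [hentry, Valuation.map_neg, map_mul]
  calc Valued.v (2 : w.1.adicCompletion L) * Valued.v (((A i j : L)) : w.1.adicCompletion L)
      ≤ 1 * Valued.v (UnitaryGroup.toPlace v w π) ^ (-((dA w.1 : ℕ) : ℤ)) := mul_le_mul' htwo ((hdA w i j).trans (exp_natCast_le_zpow_neg L v hπ w (dA w.1)))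
    _ = Valued.v (UnitaryGroup.toPlace v w π) ^ (-((dA w.1 : ℕ) : ℤ)) := one_mul _
    _ ≤ Valued.v (UnitaryGroup.toPlace v w π) ^ (-b') := zpow_le_zpow_right_of_le_one₀ (zero_lt_iff.2 h0) h1 (neg_le_neg (hb' w))

end IndexBalls
/-! ## §2 The radius bookkeeping: `(K₀ + Σ_w M + 4b + 2b′)⁺ ≤ Σ_{w∣v} (ρ w + a₁ lev + a₂ dS + a₃ dA)` -/

section Radius
/-- **the radius bookkeeping in one fibre** (pure arithmetic): with `M ≤ lev` termwise and the ABSORPTION premise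
`K₀ + 4·cb₂ ≤ (#fibre)·A + Kg·Σ_w (lev + dS + dA)` (ON `Tρ`: `A = K₀⁺ + 4cb₂`; OFF `Tρ`: `A = 0`, `K₀ + 4cb₂ ≤ Kg`, `Σ_w (lev + dS + dA) ≥ 1`),
`(K₀ + Σ_w M + 4(cb₂ + Σ_w dS) + 2 Σ_w dA)⁺ ≤ Σ_w (A + (1+Kg) lev + (4+Kg) dS + (2+Kg) dA)`. [cite: Casselman1980, §3] -/
theorem toNat_radius_le {ι : Type*} [Fintype ι] (K K₀ : ℤ) (cb₂ A Kg : ℕ) (Mw lev dS dA : ι → ℕ) (hM : ∀ w, Mw w ≤ lev w)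
    (hK : K = K₀ + (∑ w, (Mw w : ℤ)) + 4 * ((cb₂ : ℤ) + ∑ w, (dS w : ℤ)) + 2 * ∑ w, (dA w : ℤ))
    (hA : K₀ + 4 * (cb₂ : ℤ) ≤ (Fintype.card ι : ℤ) * A + Kg * ∑ w, ((lev w : ℤ) + dS w + dA w)) :
    K.toNat ≤ ∑ w, (A + (1 + Kg) * lev w + (4 + Kg) * dS w + (2 + Kg) * dA w) := by
  subst hK
  rw [Int.toNat_le]
  push_cast
  have h1 : ∑ w, (Mw w : ℤ) ≤ ∑ w, (lev w : ℤ) := Finset.sum_le_sum fun w _ => by exact_mod_cast hM w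
  have hR : ∑ w, ((A : ℤ) + (1 + Kg) * lev w + (4 + Kg) * dS w + (2 + Kg) * dA w) =
      ∑ _w : ι, (A : ℤ) + ∑ w, (Kg : ℤ) * ((lev w : ℤ) + dS w + dA w) + (∑ w, (lev w : ℤ) + 4 * ∑ w, (dS w : ℤ) + 2 * ∑ w, (dA w : ℤ)) := by
    rw [Finset.mul_sum, Finset.mul_sum, ← Finset.sum_add_distrib, ← Finset.sum_add_distrib, ← Finset.sum_add_distrib, ← Finset.sum_add_distrib]
    exact Finset.sum_congr rfl fun w _ => by ring
  have hcard : ∑ _w : ι, (A : ℤ) = (Fintype.card ι : ℤ) * A := by rw [Finset.sum_const, Finset.card_univ, nsmul_eq_mul]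
  have hKg : ∑ w, (Kg : ℤ) * ((lev w : ℤ) + dS w + dA w) = Kg * ∑ w, ((lev w : ℤ) + dS w + dA w) := (Finset.mul_sum _ _ _).symm
  rw [hR, hcard, hKg]
  linarith

/-- ON `Tρ`: the absorption premise with `A := K₀⁺ + 4cb₂` (one fibre term suffices, the fibre is non-empty). [cite: Casselman1980, §3] -/
theorem absorb_on {ι : Type*} [Fintype ι] [Nonempty ι] (K₀ : ℤ) (cb₂ Kg : ℕ) (lev dS dA : ι → ℕ) :
    K₀ + 4 * (cb₂ : ℤ) ≤ (Fintype.card ι : ℤ) * ((K₀.toNat + 4 * cb₂ : ℕ) : ℤ) + Kg * ∑ w, ((lev w : ℤ) + dS w + dA w) := by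
  have hcard : (1 : ℤ) ≤ Fintype.card ι := by exact_mod_cast Fintype.card_pos
  have hA : K₀ + 4 * (cb₂ : ℤ) ≤ ((K₀.toNat + 4 * cb₂ : ℕ) : ℤ) := by push_cast; linarith [Int.self_le_toNat K₀]
  have hS0 : (0 : ℤ) ≤ Kg * ∑ w, ((lev w : ℤ) + dS w + dA w) := mul_nonneg (Nat.cast_nonneg _) (Finset.sum_nonneg fun w _ => by positivity)
  nlinarith [(Nat.cast_nonneg _ : (0 : ℤ) ≤ ((K₀.toNat + 4 * cb₂ : ℕ) : ℤ))]

/-- OFF `Tρ`: the absorption premise with `A := 0`, from `K₀ + 4cb₂ ≤ Kg` and ONE fibre term `lev w₀ + dS w₀ + dA w₀ ≥ 1`. [cite: Casselman1980, §3] -/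
theorem absorb_off {ι : Type*} [Fintype ι] (K₀ : ℤ) (cb₂ Kg : ℕ) (hK : K₀ + 4 * (cb₂ : ℤ) ≤ Kg) (lev dS dA : ι → ℕ) (w₀ : ι) (hw₀ : 1 ≤ lev w₀ + dS w₀ + dA w₀) :
    K₀ + 4 * (cb₂ : ℤ) ≤ (Fintype.card ι : ℤ) * ((0 : ℕ) : ℤ) + Kg * ∑ w, ((lev w : ℤ) + dS w + dA w) := by
  have hone : (1 : ℤ) ≤ ∑ w, ((lev w : ℤ) + dS w + dA w) := by
    have h := Finset.single_le_sum (f := fun w => (lev w : ℤ) + dS w + dA w) (fun w _ => by positivity) (Finset.mem_univ w₀)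
    have h' : (1 : ℤ) ≤ (lev w₀ : ℤ) + dS w₀ + dA w₀ := by exact_mod_cast hw₀
    exact h'.trans h
  rw [Nat.cast_zero, mul_zero, zero_add]
  calc K₀ + 4 * (cb₂ : ℤ) ≤ Kg := hK
    _ = (Kg : ℤ) * 1 := (mul_one _).symm
    _ ≤ Kg * ∑ w, ((lev w : ℤ) + dS w + dA w) := mul_le_mul_of_nonneg_left hone (Nat.cast_nonneg _)

end Radius
/-! ## §3 HEAD: ★ p863720's `(Tρ ρ hρ a₁ a₂ a₃ hstab)` from the letters -/

section Head
variable [∀ v : HeightOneSpectrum (𝓞 (Fp L)), MeasurableSpace ↥(unipDeltaLoc L e dV hdV dW hdW v)] [∀ v : HeightOneSpectrum (𝓞 (Fp L)), BorelSpace ↥(unipDeltaLoc L e dV hdV dW hdW v)]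
  [∀ v : HeightOneSpectrum (𝓞 (Fp L)), MeasurableSpace ↥(skewMatrices (conjLocal L (IsCMField.complexConj L) v) (LocalSplitting.gramS (Fp L) L v n (gramR L e dV hdV dW hdW)))]
  [∀ v : HeightOneSpectrum (𝓞 (Fp L)), BorelSpace ↥(skewMatrices (conjLocal L (IsCMField.complexConj L) v) (LocalSplitting.gramS (Fp L) L v n (gramR L e dV hdV dW hdW)))]

set_option maxHeartbeats 1600000 in -- MEASURED: 800 000 ✗ (deterministic timeout at `whnf` of the statement — ★ p863720's two dependent `FvT` letter blocks, 800 000 there, plus the Skew-side Karel letter block of ★ p863711's shape) ∕ 1 600 000 ✓ (110 s on the farm); scoped to this decl; plain `obtain`∕`refine`∕`exact` in the head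
/-- **(R) THE RADIUS-STABILITY LETTER OF ★ p863720, HYPOTHESIS-FIRST**: from the frame `(T₀ νv π hπ FvT)`, the Siegel-section letters `hf hfc` of the factors at non-singular indices
(character family `χv`), the LEVEL letter `hMinv` of the translated factors at exponent `M h w` with `hMlev : M ≤ lev` and `hMK`, per-place constants `K₀ cb c₂` with the two-adic letter `h2`
and the UNIFORMITY letter `hTK` off a finite `TK`, and the per-place KAREL-WITH-LEVEL letter `hballM` in Skew currency (SOME ★ B2 chart at each place; the twin's conclusion shape at the CM
frame), ★ p863720 `hsizeLoc_of_place`'s binder block `(Tρ ρ hρ a₁ a₂ a₃ hstab)` is inhabited with `a₁ a₂ a₃ := 1+Kg, 4+Kg, 2+Kg` and `Tρ` := the places over `TK ∪ T₀ ∪ {(w_Δ)_v ∉ K_v}`.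
PROOF: §1 (index block in `ball(−(cb v + c₂ v + Σ_w dS w))`, `ball(−Σ_w dA w)`; ★ `beta_skew`, `beta_mul_betaInv`), `hballM` at `(M h, h_v, FvT j S h v)`, ★ B4 `evalPlace_finPart_weylDelta`,
★ `setIntegral_kindWLocalBall_eq_setIntegral_skew_tate` ×2; §2 `toNat_radius_le` with `absorb_on` ∕ `absorb_off` (★ `kindWPlaces`' five-fold union, `hMK`, `hMlev`, `hTK`).
[cite: Casselman1980, §3] [cite: KudlaRallis1994, §2] [cite: Shimura1997, §18.3–18.4] [cite: Weil1965, §37] -/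
theorem hstab_of_letters [Algebra.IsQuadraticExtension (Fp L) L]
    (T₀ : Finset (HeightOneSpectrum (𝓞 (Fp L))))
    (νv : ∀ v : HeightOneSpectrum (𝓞 (Fp L)), Measure ↥(unipDeltaLoc L e dV hdV dW hdW v))
    {π : ∀ v : HeightOneSpectrum (𝓞 (Fp L)), v.adicCompletion (Fp L)} (hπ : ∀ v, Valued.v (π v) = WithZero.exp (-1 : ℤ)) {m : ℕ}
    (FvT : Fin m → ∀ (S : skewMatrices ((IsCMField.complexConj L : L ≃ₐ[Fp L] L) : L →+* L) ((gramR L e dV hdV dW hdW).map (algebraMap (Fp L) L)))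
      (h : HA L e dV hdV dW hdW) (v : (kindWFinset L e dV hdV dW hdW T₀ (S : Matrix (Fin n) (Fin n) L) h)),
      ℂ → UnitaryGroup.localPi L (IsCMField.complexConj L) (n + n) (hermD L e dV hdV dW hdW) v.1 → ℂ)
    -- the Siegel-section letters of the factors at non-singular indices (★ p863793 §3 shapes)
    (χv : ∀ v : HeightOneSpectrum (𝓞 (Fp L)), ∀ w : UnitaryGroup.PlacesOver L v, (w.1.adicCompletion L)ˣ →* ℂˣ)
    (hf : ∀ (j : Fin m) (S : skewMatrices ((IsCMField.complexConj L : L ≃ₐ[Fp L] L) : L →+* L) ((gramR L e dV hdV dW hdW).map (algebraMap (Fp L) L)))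
      (h : HA L e dV hdV dW hdW) (v : (kindWFinset L e dV hdV dW hdW T₀ (S : Matrix (Fin n) (Fin n) L) h)) (s : ℂ), (S : Matrix (Fin n) (Fin n) L).det ≠ 0 →
      IsLocalSiegelSection (Fp L) L (IsCMField.complexConj L) (complexConj_imagUnit L) (imagUnit_ne_zero L) (imagUnit_mul_self L) v.1 n
        (gramR_isSymm L e dV hdV dW hdW) (hermD_eq_map_gramD L e dV hdV dW hdW) (χv v.1) s (FvT j S h v s))
    (hfc : ∀ (j : Fin m) (S : skewMatrices ((IsCMField.complexConj L : L ≃ₐ[Fp L] L) : L →+* L) ((gramR L e dV hdV dW hdW).map (algebraMap (Fp L) L)))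
      (h : HA L e dV hdV dW hdW) (v : (kindWFinset L e dV hdV dW hdW T₀ (S : Matrix (Fin n) (Fin n) L) h)) (s : ℂ), (S : Matrix (Fin n) (Fin n) L).det ≠ 0 →
      Continuous (FvT j S h v s))
    -- the LEVEL letter of the translated factors (★ p863964 §4 shape) and its comparison with the shared level data
    (ϖ : (w : HeightOneSpectrum (𝓞 L)) → w.adicCompletion L) (M : HA L e dV hdV dW hdW → HeightOneSpectrum (𝓞 L) → ℕ)
    (hMinv : ∀ (j : Fin m) (S : skewMatrices ((IsCMField.complexConj L : L ≃ₐ[Fp L] L) : L →+* L) ((gramR L e dV hdV dW hdW).map (algebraMap (Fp L) L)))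
      (h : HA L e dV hdV dW hdW) (v : (kindWFinset L e dV hdV dW hdW T₀ (S : Matrix (Fin n) (Fin n) L) h)) (s : ℂ)
      (y k : UnitaryGroup.localPi L (IsCMField.complexConj L) (n + n) (hermD L e dV hdV dW hdW) v.1),
      (∀ w : UnitaryGroup.PlacesOver L v.1,
        (k : UnitaryGroup.LocalGLPi L (n + n) v.1) w ∈ congruenceGL (n + n) (valuation (w.1.adicCompletion L) (ϖ w.1) ^ M h w.1)) →
      FvT j S h v s (y * k * UnitaryGroup.evalPlace (Fp L) L (IsCMField.complexConj L) (n + n) (hermD L e dV hdV dW hdW) v.1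
          (UnitaryGroup.finPart (Fp L) L (IsCMField.complexConj L) (n + n) (hermD L e dV hdV dW hdW) h)) =
        FvT j S h v s (y * UnitaryGroup.evalPlace (Fp L) L (IsCMField.complexConj L) (n + n) (hermD L e dV hdV dW hdW) v.1
          (UnitaryGroup.finPart (Fp L) L (IsCMField.complexConj L) (n + n) (hermD L e dV hdV dW hdW) h)))
    (lev : HA L e dV hdV dW hdW → HeightOneSpectrum (𝓞 L) → ℕ) (hMlev : ∀ (h : HA L e dV hdV dW hdW) (w : HeightOneSpectrum (𝓞 L)), M h w ≤ lev h w)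
    (hMK : ∀ (h : HA L e dV hdV dW hdW) (v : HeightOneSpectrum (𝓞 (Fp L))),
      UnitaryGroup.evalPlace (Fp L) L (IsCMField.complexConj L) (n + n) (hermD L e dV hdV dW hdW) v
          (UnitaryGroup.finPart (Fp L) L (IsCMField.complexConj L) (n + n) (hermD L e dV hdV dW hdW) h) ∉
        UnitaryGroup.localInt L (IsCMField.complexConj L) (n + n) (hermD L e dV hdV dW hdW) v →
      ∃ w : UnitaryGroup.PlacesOver L v, 1 ≤ M h w.1)
    -- the per-place constants, the two-adic letter and the UNIFORMITY letter
    (TK : Finset (HeightOneSpectrum (𝓞 (Fp L)))) (K₀ : HeightOneSpectrum (𝓞 (Fp L)) → ℤ) (cb c₂ : HeightOneSpectrum (𝓞 (Fp L)) → ℕ) (Kg : ℕ)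
    (hTK : ∀ v ∉ TK, K₀ v + 4 * ((cb v : ℤ) + c₂ v) ≤ Kg)
    (h2 : ∀ (v : HeightOneSpectrum (𝓞 (Fp L))) (w : UnitaryGroup.PlacesOver L v),
      Valued.v (UnitaryGroup.toPlace v w (π v)) ^ (c₂ v : ℤ) ≤ Valued.v (2 : w.1.adicCompletion L))
    -- the per-place KAREL-WITH-LEVEL letter in Skew currency (twin shape at the CM frame), in SOME ★ B2 chart
    (hballM : ∀ v : HeightOneSpectrum (𝓞 (Fp L)),
      ∃ ψ : ↥(unipDeltaLoc L e dV hdV dW hdW v) ≃ₜ ↥(skewMatrices (conjLocal L (IsCMField.complexConj L) v) (LocalSplitting.gramS (Fp L) L v n (gramR L e dV hdV dW hdW))),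
        (∀ u, (ψ u).1 = blkB (LocalSplitting.matA (Fp L) L (IsCMField.complexConj L) v n
          (u : UnitaryGroup.localPi L (IsCMField.complexConj L) (n + n) (hermD L e dV hdV dW hdW) v))) ∧
        ∀ (Mv : UnitaryGroup.PlacesOver L v → ℕ) (x : UnitaryGroup.localPi L (IsCMField.complexConj L) (n + n) (hermD L e dV hdV dW hdW) v)
          (f : ℂ → UnitaryGroup.localPi L (IsCMField.complexConj L) (n + n) (hermD L e dV hdV dW hdW) v → ℂ),
          (∀ s, IsLocalSiegelSection (Fp L) L (IsCMField.complexConj L) (complexConj_imagUnit L) (imagUnit_ne_zero L) (imagUnit_mul_self L) v n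
            (gramR_isSymm L e dV hdV dW hdW) (hermD_eq_map_gramD L e dV hdV dW hdW) (χv v) s (f s)) →
          (∀ s g (k : UnitaryGroup.localPi L (IsCMField.complexConj L) (n + n) (hermD L e dV hdV dW hdW) v),
            (∀ w : UnitaryGroup.PlacesOver L v,
              (k : UnitaryGroup.LocalGLPi L (n + n) v) w ∈ congruenceGL (n + n) (valuation (w.1.adicCompletion L) (ϖ w.1) ^ Mv w)) →
            f s (g * k * x) = f s (g * x)) →
          (∀ s, Continuous (f s)) →
          ∀ (b b' : ℤ) (β βinv : Matrix (Fin n) (Fin n) (UnitaryGroup.LocalRing L v)), 0 ≤ b → 0 ≤ b' → (cb v : ℤ) ≤ b →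
            (β.map (conjLocal L (IsCMField.complexConj L) v))ᵀ * LocalSplitting.gramS (Fp L) L v n (gramR L e dV hdV dW hdW) +
              LocalSplitting.gramS (Fp L) L v n (gramR L e dV hdV dW hdW) * β = 0 →
            β * βinv = 1 →
            (∀ i j (w : UnitaryGroup.PlacesOver L v), Valued.v (β i j w) ≤ Valued.v (UnitaryGroup.toPlace v w (π v)) ^ (-b)) →
            (∀ i j (w : UnitaryGroup.PlacesOver L v), Valued.v (βinv i j w) ≤ Valued.v (UnitaryGroup.toPlace v w (π v)) ^ (-b')) →
            ∀ (s : ℂ) (k : ℤ), K₀ v + (∑ w : UnitaryGroup.PlacesOver L v, (Mv w : ℤ)) + 4 * b + 2 * b' ≤ k →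
              ∫ t in {t : ↥(skewMatrices (conjLocal L (IsCMField.complexConj L) v) (LocalSplitting.gramS (Fp L) L v n (gramR L e dV hdV dW hdW))) |
                  ∀ i j (w : UnitaryGroup.PlacesOver L v), Valued.v (t.1 i j w) ≤ Valued.v (UnitaryGroup.toPlace v w (π v)) ^ (-k)},
                f s (LocalSplitting.weylDelta (Fp L) L (IsCMField.complexConj L) v n (hermD_eq_map_gramD L e dV hdV dW hdW) *
                    LocalSplitting.nElem (Fp L) L (IsCMField.complexConj L) v n (hermD_eq_map_gramD L e dV hdV dW hdW) t.1
                      ((add_comm _ _).trans ((mem_skewMatrices_iff _ _ t.1).1 t.2)) * x) *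
                  ((adeleAddCharAt (Fp L) v (-(Algebra.trace (v.adicCompletion (Fp L)) (UnitaryGroup.LocalRing L v) (Matrix.trace (β * t.1)))) : Circle) : ℂ)
                ∂(Measure.map ψ (νv v)) =
              ∫ t in {t : ↥(skewMatrices (conjLocal L (IsCMField.complexConj L) v) (LocalSplitting.gramS (Fp L) L v n (gramR L e dV hdV dW hdW))) |
                  ∀ i j (w : UnitaryGroup.PlacesOver L v), Valued.v (t.1 i j w) ≤
                    Valued.v (UnitaryGroup.toPlace v w (π v)) ^ (-(K₀ v + (∑ w : UnitaryGroup.PlacesOver L v, (Mv w : ℤ)) + 4 * b + 2 * b'))},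
                f s (LocalSplitting.weylDelta (Fp L) L (IsCMField.complexConj L) v n (hermD_eq_map_gramD L e dV hdV dW hdW) *
                    LocalSplitting.nElem (Fp L) L (IsCMField.complexConj L) v n (hermD_eq_map_gramD L e dV hdV dW hdW) t.1
                      ((add_comm _ _).trans ((mem_skewMatrices_iff _ _ t.1).1 t.2)) * x) *
                  ((adeleAddCharAt (Fp L) v (-(Algebra.trace (v.adicCompletion (Fp L)) (UnitaryGroup.LocalRing L v) (Matrix.trace (β * t.1)))) : Circle) : ℂ)
                ∂(Measure.map ψ (νv v))) :
    ∃ (Tρ : Finset (HeightOneSpectrum (𝓞 L))) (ρ : HeightOneSpectrum (𝓞 L) → ℕ) (a₁ a₂ a₃ : ℕ), (∀ w ∉ Tρ, ρ w = 0) ∧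
      ∀ (j : Fin m) (S : skewMatrices ((IsCMField.complexConj L : L ≃ₐ[Fp L] L) : L →+* L) ((gramR L e dV hdV dW hdW).map (algebraMap (Fp L) L)))
        (h : HA L e dV hdV dW hdW) (v : (kindWFinset L e dV hdV dW hdW T₀ (S : Matrix (Fin n) (Fin n) L) h)), (S : Matrix (Fin n) (Fin n) L).det ≠ 0 →
        ∀ (s : ℂ) (dS dA : HeightOneSpectrum (𝓞 L) → ℕ),
        (∀ (w : UnitaryGroup.PlacesOver L v.1) (a b : Fin n), Valued.v ((((S : Matrix (Fin n) (Fin n) L) a b : L)) : w.1.adicCompletion L) ≤ WithZero.exp ((dS w.1 : ℕ) : ℤ)) →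
        (∀ (w : UnitaryGroup.PlacesOver L v.1) (a b : Fin n), Valued.v ((((S : Matrix (Fin n) (Fin n) L)⁻¹ a b : L)) : w.1.adicCompletion L) ≤ WithZero.exp ((dA w.1 : ℕ) : ℤ)) →
        ∃ R : ℕ, R ≤ ∑ w : UnitaryGroup.PlacesOver L v.1, (ρ w.1 + a₁ * lev h w.1 + a₂ * dS w.1 + a₃ * dA w.1) ∧
          ∀ k' : ℕ, R ≤ k' →
            ∫ y in kindWLocalBall L e dV hdV dW hdW v.1 (π v.1) (-(k' : ℤ)),
              conj (unipDeltaChar L e dV hdV dW hdW (S : Matrix (Fin n) (Fin n) L)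
                  (locToAdelic L e dV hdV dW hdW v.1
                    ((y : ↥(unipDeltaLoc L e dV hdV dW hdW v.1)) : UnitaryGroup.localPi L (IsCMField.complexConj L) (n + n) (hermD L e dV hdV dW hdW) v.1)) : ℂ) *
                FvT j S h v s (UnitaryGroup.evalPlace (Fp L) L (IsCMField.complexConj L) (n + n) (hermD L e dV hdV dW hdW) v.1
                      (UnitaryGroup.finPart (Fp L) L (IsCMField.complexConj L) (n + n) (hermD L e dV hdV dW hdW) (weylDelta L e dV hdV dW hdW)) *
                    ((y : ↥(unipDeltaLoc L e dV hdV dW hdW v.1)) : UnitaryGroup.localPi L (IsCMField.complexConj L) (n + n) (hermD L e dV hdV dW hdW) v.1) *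
                    UnitaryGroup.evalPlace (Fp L) L (IsCMField.complexConj L) (n + n) (hermD L e dV hdV dW hdW) v.1
                      (UnitaryGroup.finPart (Fp L) L (IsCMField.complexConj L) (n + n) (hermD L e dV hdV dW hdW) h)) ∂(νv v.1) =
            ∫ y in kindWLocalBall L e dV hdV dW hdW v.1 (π v.1) (-(R : ℤ)),
              conj (unipDeltaChar L e dV hdV dW hdW (S : Matrix (Fin n) (Fin n) L)
                  (locToAdelic L e dV hdV dW hdW v.1
                    ((y : ↥(unipDeltaLoc L e dV hdV dW hdW v.1)) : UnitaryGroup.localPi L (IsCMField.complexConj L) (n + n) (hermD L e dV hdV dW hdW) v.1)) : ℂ) *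
                FvT j S h v s (UnitaryGroup.evalPlace (Fp L) L (IsCMField.complexConj L) (n + n) (hermD L e dV hdV dW hdW) v.1
                      (UnitaryGroup.finPart (Fp L) L (IsCMField.complexConj L) (n + n) (hermD L e dV hdV dW hdW) (weylDelta L e dV hdV dW hdW)) *
                    ((y : ↥(unipDeltaLoc L e dV hdV dW hdW v.1)) : UnitaryGroup.localPi L (IsCMField.complexConj L) (n + n) (hermD L e dV hdV dW hdW) v.1) *
                    UnitaryGroup.evalPlace (Fp L) L (IsCMField.complexConj L) (n + n) (hermD L e dV hdV dW hdW) v.1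
                      (UnitaryGroup.finPart (Fp L) L (IsCMField.complexConj L) (n + n) (hermD L e dV hdV dW hdW) h)) ∂(νv v.1) := by
  classical
  -- the fixed finite sets: `T_Δ := {v : (w_Δ)_v ∉ K_v}`, `Tbad := TK ∪ T₀ ∪ T_Δ`, `Tρ :=` the places of `L` over `Tbad`; `ρv v := (K₀ v)⁺ + 4 (cb v + c₂ v)`
  have hΔfin := Filter.eventually_cofinite.1 (UnitaryGroup.eventually_evalPlace_mem_localInt (Fp L) L (IsCMField.complexConj L) (n + n) (hermD L e dV hdV dW hdW)
    (UnitaryGroup.finPart (Fp L) L (IsCMField.complexConj L) (n + n) (hermD L e dV hdV dW hdW) (weylDelta L e dV hdV dW hdW)))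
  obtain ⟨Tbad, hTbad⟩ : ∃ T : Finset (HeightOneSpectrum (𝓞 (Fp L))), T = TK ∪ T₀ ∪ hΔfin.toFinset := ⟨_, rfl⟩
  refine ⟨Tbad.biUnion fun v' => (Finset.univ : Finset (UnitaryGroup.PlacesOver L v')).map (Function.Embedding.subtype _),
    fun w => if w.under (𝓞 (Fp L)) ∈ Tbad then (K₀ (w.under (𝓞 (Fp L)))).toNat + 4 * (cb (w.under (𝓞 (Fp L))) + c₂ (w.under (𝓞 (Fp L)))) else 0,
    1 + Kg, 4 + Kg, 2 + Kg, fun w hw => ?_, ?_⟩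
  · dsimp only -- `ρ` vanishes off `Tρ`
    split_ifs with hmem
    · exact absurd (Finset.mem_biUnion.2 ⟨w.under (𝓞 (Fp L)), hmem,
        Finset.mem_map.2 ⟨(⟨w, rfl⟩ : UnitaryGroup.PlacesOver L (w.under (𝓞 (Fp L)))), Finset.mem_univ _, rfl⟩⟩) hw
    · rfl
  intro j S h v hdet s dS dA hdS hdA
  obtain ⟨ψ, hψ, hKarel⟩ := hballM v.1
  have hSk : ∀ t, t ∈ skewMatrices (conjLocal L (IsCMField.complexConj L) v.1) (LocalSplitting.gramS (Fp L) L v.1 n (gramR L e dV hdV dW hdW)) ↔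
      (t.map (conjLocal L (IsCMField.complexConj L) v.1))ᵀ * LocalSplitting.gramS (Fp L) L v.1 n (gramR L e dV hdV dW hdW) +
        LocalSplitting.gramS (Fp L) L v.1 n (gramR L e dV hdV dW hdW) * t = 0 :=
    fun t => (mem_skewMatrices_iff _ _ t).trans (by rw [add_comm])
  obtain ⟨b, hbdef⟩ : ∃ b : ℤ, b = ((cb v.1 + c₂ v.1 + ∑ w : UnitaryGroup.PlacesOver L v.1, dS w.1 : ℕ) : ℤ) := ⟨_, rfl⟩
  obtain ⟨b', hb'def⟩ : ∃ b' : ℤ, b' = ((∑ w : UnitaryGroup.PlacesOver L v.1, dA w.1 : ℕ) : ℤ) := ⟨_, rfl⟩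
  have hβ := beta_mem_ball L v.1 (hπ v.1) (h2 v.1) (S : Matrix (Fin n) (Fin n) L) dS hdS (b := b) fun w => by
    have h1 := Finset.single_le_sum (f := fun w' : UnitaryGroup.PlacesOver L v.1 => dS w'.1) (fun _ _ => Nat.zero_le _) (Finset.mem_univ w)
    rw [hbdef]; push_cast; linarith
  have hβinv := betaInv_mem_ball L v.1 (hπ v.1) ((S : Matrix (Fin n) (Fin n) L)⁻¹) dA hdA (b' := b') fun w => by
    rw [hb'def]; exact_mod_cast Finset.single_le_sum (f := fun w' : UnitaryGroup.PlacesOver L v.1 => dA w'.1) (fun _ _ => Nat.zero_le _) (Finset.mem_univ w)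
  have key := hKarel (fun w => M h w.1)
    (UnitaryGroup.evalPlace (Fp L) L (IsCMField.complexConj L) (n + n) (hermD L e dV hdV dW hdW) v.1
      (UnitaryGroup.finPart (Fp L) L (IsCMField.complexConj L) (n + n) (hermD L e dV hdV dW hdW) h))
    (FvT j S h v) (fun s => hf j S h v s hdet) (fun s y k hk => hMinv j S h v s y k hk) (fun s => hfc j S h v s hdet) b b' _ _
    (by rw [hbdef]; exact Nat.cast_nonneg _) (by rw [hb'def]; exact Nat.cast_nonneg _)
    (by rw [hbdef]; push_cast; linarith [Finset.sum_nonneg fun (w : UnitaryGroup.PlacesOver L v.1) (_ : w ∈ Finset.univ) => (Nat.cast_nonneg (dS w.1) : (0 : ℤ) ≤ dS w.1)])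
    (beta_skew L e dV hdV dW hdW v.1 S) (beta_mul_betaInv L e dV hdV dW hdW v.1 S hdet) hβ hβinv s
  obtain ⟨R, hR⟩ : ∃ R : ℕ, R = (K₀ v.1 + (∑ w : UnitaryGroup.PlacesOver L v.1, ((M h w.1 : ℕ) : ℤ)) + 4 * b + 2 * b').toNat := ⟨_, rfl⟩
  refine ⟨R, ?_, fun k' hk' => ?_⟩
  · -- §2: the radius bookkeeping
    have hρ : ∀ w : UnitaryGroup.PlacesOver L v.1,
        (if w.1.under (𝓞 (Fp L)) ∈ Tbad then (K₀ (w.1.under (𝓞 (Fp L)))).toNat + 4 * (cb (w.1.under (𝓞 (Fp L))) + c₂ (w.1.under (𝓞 (Fp L)))) else 0) =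
          (if v.1 ∈ Tbad then (K₀ v.1).toNat + 4 * (cb v.1 + c₂ v.1) else 0) := fun w => by rw [w.2]
    simp only [hρ]
    rw [hR]
    have hK : K₀ v.1 + (∑ w : UnitaryGroup.PlacesOver L v.1, ((M h w.1 : ℕ) : ℤ)) + 4 * b + 2 * b' =
        K₀ v.1 + (∑ w : UnitaryGroup.PlacesOver L v.1, ((M h w.1 : ℕ) : ℤ)) +
          4 * (((cb v.1 + c₂ v.1 : ℕ) : ℤ) + ∑ w : UnitaryGroup.PlacesOver L v.1, ((dS w.1 : ℕ) : ℤ)) + 2 * ∑ w : UnitaryGroup.PlacesOver L v.1, ((dA w.1 : ℕ) : ℤ) := by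
      rw [hbdef, hb'def]; push_cast; ring
    by_cases hbad : v.1 ∈ Tbad
    · rw [if_pos hbad]
      refine toNat_radius_le (ι := UnitaryGroup.PlacesOver L v.1) _ (K₀ v.1) (cb v.1 + c₂ v.1) _ Kg (fun w => M h w.1) (fun w => lev h w.1) (fun w => dS w.1) (fun w => dA w.1)
        (fun w => hMlev h w.1) hK ?_
      exact absorb_on (K₀ v.1) (cb v.1 + c₂ v.1) Kg (fun w : UnitaryGroup.PlacesOver L v.1 => lev h w.1) (fun w => dS w.1) fun w => dA w.1
    · rw [if_neg hbad] -- OFF `Tbad`: `v ∉ TK ∪ T₀ ∪ T_Δ`, and `v ∈ U(S,h)` forces `h_v ∉ K_v` or a non-integral entry of `S`, `S⁻¹` above `v`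
      have hnot : v.1 ∉ TK ∧ v.1 ∉ T₀ ∧ v.1 ∉ hΔfin.toFinset := by simpa only [hTbad, Finset.mem_union, not_or, and_assoc] using hbad
      have hw₀ : ∃ w₀ : UnitaryGroup.PlacesOver L v.1, 1 ≤ lev h w₀.1 + dS w₀.1 + dA w₀.1 := by
        have hv := (mem_kindWFinset L e dV hdV dW hdW).1 v.2
        simp only [kindWPlaces, Set.mem_union, Set.mem_setOf_eq, Finset.mem_coe] at hv
        rcases hv with (((hT | hh) | hw) | ⟨w, i, i', hSi⟩) | ⟨w, i, i', hSi⟩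
        · exact absurd hT hnot.2.1
        · obtain ⟨w, hw⟩ := hMK h v.1 hh
          exact ⟨w, by have := hMlev h w.1; omega⟩
        · exact absurd (hΔfin.mem_toFinset.2 hw) hnot.2.2
        · refine ⟨w, ?_⟩
          have hne : dS w.1 ≠ 0 := fun h0 => hSi ((HeightOneSpectrum.mem_adicCompletionIntegers _ _ _).2 (by simpa [h0] using hdS w i i'))
          omega
        · refine ⟨w, ?_⟩
          have hne : dA w.1 ≠ 0 := fun h0 => hSi ((HeightOneSpectrum.mem_adicCompletionIntegers _ _ _).2 (by simpa [h0] using hdA w i i'))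
          omega
      obtain ⟨w₀, hw₀⟩ := hw₀
      refine toNat_radius_le (ι := UnitaryGroup.PlacesOver L v.1) _ (K₀ v.1) (cb v.1 + c₂ v.1) 0 Kg (fun w => M h w.1) (fun w => lev h w.1) (fun w => dS w.1) (fun w => dA w.1)
        (fun w => hMlev h w.1) hK ?_
      exact absorb_off (K₀ v.1) (cb v.1 + c₂ v.1) Kg (by push_cast; exact hTK v.1 hnot.1)
        (fun w : UnitaryGroup.PlacesOver L v.1 => lev h w.1) (fun w => dS w.1) (fun w => dA w.1) w₀ hw₀
  · -- §3: stability — ★ B4 `evalPlace_finPart_weylDelta`, the ball transport ×2 and the Karel letter at `k′` and at `R`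
    have hRle : K₀ v.1 + (∑ w : UnitaryGroup.PlacesOver L v.1, ((M h w.1 : ℕ) : ℤ)) + 4 * b + 2 * b' ≤ (R : ℤ) := by
      rw [hR]; exact Int.self_le_toNat _
    have hk : K₀ v.1 + (∑ w : UnitaryGroup.PlacesOver L v.1, ((M h w.1 : ℕ) : ℤ)) + 4 * b + 2 * b' ≤ (k' : ℤ) := hRle.trans (by exact_mod_cast hk')
    rw [evalPlace_finPart_weylDelta]
    exact (setIntegral_kindWLocalBall_eq_setIntegral_skew_tate L e dV hdV dW hdW v.1 _ hSk (hπ v.1) ψ hψ (νv v.1) (S : Matrix (Fin n) (Fin n) L)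
      (fun y => FvT j S h v s (LocalSplitting.weylDelta (Fp L) L (IsCMField.complexConj L) v.1 n (hermD_eq_map_gramD L e dV hdV dW hdW) * y *
        UnitaryGroup.evalPlace (Fp L) L (IsCMField.complexConj L) (n + n) (hermD L e dV hdV dW hdW) v.1
          (UnitaryGroup.finPart (Fp L) L (IsCMField.complexConj L) (n + n) (hermD L e dV hdV dW hdW) h))) (-(k' : ℤ))).trans
      (((key (k' : ℤ) hk).trans (key (R : ℤ) hRle).symm).trans
        (setIntegral_kindWLocalBall_eq_setIntegral_skew_tate L e dV hdV dW hdW v.1 _ hSk (hπ v.1) ψ hψ (νv v.1) (S : Matrix (Fin n) (Fin n) L)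
          (fun y => FvT j S h v s (LocalSplitting.weylDelta (Fp L) L (IsCMField.complexConj L) v.1 n (hermD_eq_map_gramD L e dV hdV dW hdW) * y *
            UnitaryGroup.evalPlace (Fp L) L (IsCMField.complexConj L) (n + n) (hermD L e dV hdV dW hdW) v.1
              (UnitaryGroup.finPart (Fp L) L (IsCMField.complexConj L) (n + n) (hermD L e dV hdV dW hdW) h))) (-(R : ℤ))).symm)

end Head
end Summit.HodgeConjecture.HodgeConjecture.Cruxes.HLiu418.K2LiuKindWFiniteRadiusStabilityOfLetters

end
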